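import Literature.LinearAlgebra.Matrix.FrameConjugatedExponential
import HarnessLib

/-!
# Loewner enclosures of `exp(−G)` for a frame-conjugated `G = ḡ·1 + K diag(g − ḡ) Kᴴ` with a nearly
# orthonormal frame `K` (certificate form), and the exact-arithmetic interface

Topic `LinearAlgebra/Matrix`; namespace `Literature.LinearAlgebra.Matrix.FrameExponential`; sequel of
`FrameConjugatedExponential.lean` (the operator-norm remainder bound
`‖exp (K D Kᴴ) − 1 − K (exp D − 1) Kᴴ‖ ≤ θ(α, ε) = e^{(1+ε)α} − (1+ε)e^{α} + ε` for `‖KᴴK − 1‖ ≤ ε`, `‖D‖ ≤ α`).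
Everything is PROVED; no definition, no named fact. `RCLike 𝕜`, `ℓ²`-operator norms
(`open scoped Matrix.Norms.L2Operator`), Loewner order (`open scoped MatrixOrder`), `exp = NormedSpace.exp`.

* §1 `|λ_i(X)| ≤ ‖X‖` for Hermitian `X` (`abs_eigenvalues_le_norm`) and the Loewner enclosure from a norm bound
  `‖X‖ ≤ θ ⟹ −θ·1 ≤ X ≤ θ·1` (`neg_smul_one_le_and_le_smul_one_of_norm_le`); real diagonal data: norm, `exp`,
  Hermitian-ness.
* §2 THE ENCLOSURES: `−θ·1 ≤ exp (K diag(a) Kᴴ) − 1 − K diag(e^{a_k} − 1) Kᴴ ≤ θ·1` for `|a_k| ≤ α`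
  (`exp_frameConj_diagonal_loewner`) and the CERTIFICATE FORM (`exp_neg_shift_frameConj_loewner`): for levels
  `g_k ≤ ḡ` with `ḡ − g_k ≤ α` and `G := ḡ·1 + K diag(g_k − ḡ) Kᴴ`,
  `e^{−ḡ}(1 − θ)·1 + K diag(e^{−g_k} − e^{−ḡ}) Kᴴ ≤ exp(−G) ≤ e^{−ḡ}(1 + θ)·1 + K diag(e^{−g_k} − e^{−ḡ}) Kᴴ`;
  the same for `cfc Real.exp (−G)` over `ℂ` (`cfc_exp_neg_shift_frameConj_loewner`), the form in which Löwner
  certificates `e^{c}·e^{L_B} − tr_x exp(−H + Γ L_B) ⪰ 0` of conditional free-energy bounds are stated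
  (`Literature.MathematicalPhysics.QuantumLattice.FermionConditionalFreeEnergyCertificate`).
* §3 the exact-arithmetic interface `Σ_{ij} |E_ij|² ≤ ε² ⟹ ‖E‖ ≤ ε` (`l2_opNorm_le_of_sum_sq_le`).

USE (kept-frame witnesses of a numerically produced eigen-decomposition, entries rounded to dyadic rationals):
with `K` the kept columns, `ε` any rational with `ε² ≥ Σ_{ij} |(KᵀK − 1)_{ij}|²`, `g` the dyadic levels, `ḡ` the
floor level and `α = ḡ − min_k g_k`, every real number in the two bounds is an explicit exponential, so rational
outward roundings (`FixedPointExp` enclosures) give RATIONAL matrices `L ≤ exp(−G) ≤ U` checkable by `LDLᵀ`.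

REUSED: `Matrix.l2_opNorm_mulVec`, `Matrix.l2_opNorm_diagonal`, `Matrix.l2_opNorm_toEuclideanCLM`,
`Matrix.IsHermitian.mulVec_eigenvectorBasis` / `spectrum_real_eq_range_eigenvalues` / `IsHermitian.exp`,
`Matrix.isHermitian_mul_mul_conjTranspose`, `CFC.real_exp_eq_normedSpace_exp`, `Finset.sum_mul_sq_le_sq_mul_sq`
(Mathlib); `PolarOrthonormalization.le_smul_one_of_forall_mem_spectrum` / `smul_one_le_of_forall_mem_spectrum`
(tree); `norm_exp_frameConj_sub_le`, `exp_smul_one_add` (prequel).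

## References

* N. J. Higham, *Functions of Matrices* (SIAM 2008), §10.1 (exponential: series and truncation errors),
  Problem 1.33 (`f(αI + A)`), Thm. 1.13. [cite: Higham2008, §10.1, Problem 1.33]
* R. A. Horn, C. R. Johnson, *Matrix Analysis*, 2nd ed. (2013), Thm. 5.6.9 (`ρ(A) ≤ ‖A‖`), §5.6
  (`‖A‖₂ ≤ ‖A‖_F`), §7.7 (Loewner order). [cite: HornJohnson2013, Thm. 5.6.9, §5.6, §7.7]
-/

noncomputable section

open scoped Matrix.Norms.L2Operator MatrixOrder ComplexOrder
open NormedSpace Matrix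

namespace Literature.LinearAlgebra.Matrix

namespace FrameExponential

variable {𝕜 : Type*} [RCLike 𝕜] {m n : Type*} [Fintype m] [Fintype n] [DecidableEq m] [DecidableEq n]

/-! ### §1 Norm bounds in the Loewner order; real diagonal data -/

omit [Fintype m] [DecidableEq m] in
/-- **Eigenvalues are bounded by the operator norm**: `|λ_i(X)| ≤ ‖X‖` for Hermitian `X` (unit eigenvector `v`,
`|λ| = ‖X v‖ ≤ ‖X‖`). [cite: HornJohnson2013, Thm. 5.6.9] -/
theorem abs_eigenvalues_le_norm {X : Matrix n n 𝕜} (hX : X.IsHermitian) (i : n) : |hX.eigenvalues i| ≤ ‖X‖ := by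
  have hv : ‖hX.eigenvectorBasis i‖ = 1 := hX.eigenvectorBasis.orthonormal.1 i
  have h1 := Matrix.l2_opNorm_mulVec X (hX.eigenvectorBasis i)
  rw [hX.mulVec_eigenvectorBasis i, hv, mul_one] at h1
  have h2 : (EuclideanSpace.equiv n 𝕜).symm ((hX.eigenvalues i) • ⇑(hX.eigenvectorBasis i)) =
      (hX.eigenvalues i) • hX.eigenvectorBasis i := rfl
  rw [h2, norm_smul, hv, mul_one, Real.norm_eq_abs] at h1
  exact h1

omit [Fintype m] [DecidableEq m] in
/-- **Loewner enclosure from a norm bound**: a Hermitian `X` with `‖X‖ ≤ θ` satisfies `−θ·1 ≤ X ≤ θ·1`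
(spectrum in `[−θ, θ]`). [cite: HornJohnson2013, §7.7] -/
theorem neg_smul_one_le_and_le_smul_one_of_norm_le {X : Matrix n n 𝕜} (hX : X.IsHermitian) {θ : ℝ}
    (h : ‖X‖ ≤ θ) : -(((θ : ℝ) : 𝕜) • (1 : Matrix n n 𝕜)) ≤ X ∧ X ≤ ((θ : ℝ) : 𝕜) • (1 : Matrix n n 𝕜) := by
  have hspec : ∀ x ∈ spectrum ℝ X, |x| ≤ θ := by
    intro x hx
    rw [hX.spectrum_real_eq_range_eigenvalues] at hx
    obtain ⟨i, rfl⟩ := hx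
    exact (abs_eigenvalues_le_norm hX i).trans h
  refine ⟨?_, PolarOrthonormalization.le_smul_one_of_forall_mem_spectrum hX fun x hx => (abs_le.1 (hspec x hx)).2⟩
  have hlo := PolarOrthonormalization.smul_one_le_of_forall_mem_spectrum hX (c := -θ)
    fun x hx => (abs_le.1 (hspec x hx)).1
  rwa [RCLike.ofReal_neg, neg_smul] at hlo

omit [Fintype m] [DecidableEq m] in
/-- A real diagonal matrix with entries in `[−α, α]` has operator norm `≤ α`. [cite: HornJohnson2013, §5.6] -/
theorem norm_diagonal_ofReal_le {a : n → ℝ} {α : ℝ} (hα : 0 ≤ α) (ha : ∀ k, |a k| ≤ α) :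
    ‖(diagonal (fun k => ((a k : ℝ) : 𝕜)) : Matrix n n 𝕜)‖ ≤ α := by
  rw [Matrix.l2_opNorm_diagonal]
  refine (pi_norm_le_iff_of_nonneg hα).2 fun k => ?_
  rw [RCLike.norm_ofReal]
  exact ha k

omit [Fintype m] [DecidableEq m] in
/-- `exp diag(a) = diag(e^{a})` for real levels written in `𝕜`. [cite: Higham2008, Thm. 1.13] -/
theorem exp_diagonal_ofReal (a : n → ℝ) :
    exp (diagonal (fun k => ((a k : ℝ) : 𝕜))) = diagonal (fun k => ((Real.exp (a k) : ℝ) : 𝕜)) := by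
  rw [Matrix.exp_diagonal]
  congr 1
  funext k
  rw [Pi.coe_exp, Real.exp_eq_exp_ℝ]
  exact (algebraMap_exp_comm (𝔸 := 𝕜) (a k)).symm

omit [Fintype m] [Fintype n] [DecidableEq m] in
/-- A real diagonal matrix written in `𝕜` is Hermitian. [cite: HornJohnson2013, §4.1] -/
theorem isHermitian_diagonal_ofReal (a : n → ℝ) : (diagonal (fun k => ((a k : ℝ) : 𝕜)) : Matrix n n 𝕜).IsHermitian :=
  isHermitian_diagonal_iff.2 fun k => by
    rw [IsSelfAdjoint, RCLike.star_def, RCLike.conj_ofReal]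

/-! ### §2 The enclosures -/

/-- **Two-sided Loewner enclosure of `exp (K diag(a) Kᴴ)` for a nearly orthonormal frame**: `‖Kᴴ K − 1‖ ≤ ε`
(`ε ≥ 0`), `|a_k| ≤ α` (`α ≥ 0`), `θ := e^{(1+ε)α} − (1+ε)e^{α} + ε` ⟹
`−θ·1 ≤ exp (K diag(a) Kᴴ) − 1 − K diag(e^{a_k} − 1) Kᴴ ≤ θ·1`. [cite: Higham2008, §10.1] [cite: HornJohnson2013, §7.7] -/
theorem exp_frameConj_diagonal_loewner {K : Matrix m n 𝕜} {ε α : ℝ} (hε : 0 ≤ ε) (hP : ‖Kᴴ * K - 1‖ ≤ ε)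
    {a : n → ℝ} (hα : 0 ≤ α) (ha : ∀ k, |a k| ≤ α) :
    -((((Real.exp ((1 + ε) * α) - (1 + ε) * Real.exp α + ε : ℝ)) : 𝕜) • (1 : Matrix m m 𝕜)) ≤
        exp (K * diagonal (fun k => ((a k : ℝ) : 𝕜)) * Kᴴ) - 1 -
          K * diagonal (fun k => ((Real.exp (a k) - 1 : ℝ) : 𝕜)) * Kᴴ ∧
      exp (K * diagonal (fun k => ((a k : ℝ) : 𝕜)) * Kᴴ) - 1 -
          K * diagonal (fun k => ((Real.exp (a k) - 1 : ℝ) : 𝕜)) * Kᴴ ≤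
        (((Real.exp ((1 + ε) * α) - (1 + ε) * Real.exp α + ε : ℝ)) : 𝕜) • (1 : Matrix m m 𝕜) := by
  have hexpD : exp (diagonal (fun k => ((a k : ℝ) : 𝕜))) - 1 =
      diagonal (fun k => ((Real.exp (a k) - 1 : ℝ) : 𝕜)) := by
    rw [exp_diagonal_ofReal, ← diagonal_one, diagonal_sub]
    congr 1
    funext k
    push_cast
    ring
  have hbound := norm_exp_frameConj_sub_le hε hP (norm_diagonal_ofReal_le (𝕜 := 𝕜) hα ha)
  rw [hexpD] at hbound
  refine neg_smul_one_le_and_le_smul_one_of_norm_le ?_ hbound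
  have hD : (K * diagonal (fun k => ((a k : ℝ) : 𝕜)) * Kᴴ).IsHermitian :=
    isHermitian_mul_mul_conjTranspose K (isHermitian_diagonal_ofReal a)
  exact (hD.exp.sub isHermitian_one).sub
    (isHermitian_mul_mul_conjTranspose K (isHermitian_diagonal_ofReal fun k => Real.exp (a k) - 1))

/-- **The kept-frame enclosure in certificate form.** `K ∈ 𝕜^{m×n}` with `‖Kᴴ K − 1‖ ≤ ε` (`ε ≥ 0`; e.g.
`ε² ≥ ‖Kᴴ K − 1‖_F²` checked in exact arithmetic), levels `g_k ≤ ḡ` with `ḡ − g_k ≤ α` (`α ≥ 0`),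
`G := ḡ·1 + K diag(g_k − ḡ) Kᴴ`, `θ := e^{(1+ε)α} − (1+ε)e^{α} + ε`. Then, in the Loewner order,
`e^{−ḡ}(1 − θ)·1 + K diag(e^{−g_k} − e^{−ḡ}) Kᴴ ≤ exp(−G) ≤ e^{−ḡ}(1 + θ)·1 + K diag(e^{−g_k} − e^{−ḡ}) Kᴴ`
(`exp(−G) = e^{−ḡ}·exp(K diag(ḡ − g) Kᴴ)` and the previous enclosure). [cite: Higham2008, §10.1, Problem 1.33]
[cite: HornJohnson2013, §7.7] -/
theorem exp_neg_shift_frameConj_loewner {K : Matrix m n 𝕜} {ε α gbar : ℝ} (hε : 0 ≤ ε) (hP : ‖Kᴴ * K - 1‖ ≤ ε)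
    (hα : 0 ≤ α) {g : n → ℝ} (hg : ∀ k, g k ≤ gbar) (hgα : ∀ k, gbar - g k ≤ α) :
    ((Real.exp (-gbar) * (1 - (Real.exp ((1 + ε) * α) - (1 + ε) * Real.exp α + ε)) : ℝ) : 𝕜) •
          (1 : Matrix m m 𝕜) + K * diagonal (fun k => ((Real.exp (-g k) - Real.exp (-gbar) : ℝ) : 𝕜)) * Kᴴ ≤
        exp (-((((gbar : ℝ)) : 𝕜) • (1 : Matrix m m 𝕜) + K * diagonal (fun k => ((g k - gbar : ℝ) : 𝕜)) * Kᴴ)) ∧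
      exp (-((((gbar : ℝ)) : 𝕜) • (1 : Matrix m m 𝕜) + K * diagonal (fun k => ((g k - gbar : ℝ) : 𝕜)) * Kᴴ)) ≤
        ((Real.exp (-gbar) * (1 + (Real.exp ((1 + ε) * α) - (1 + ε) * Real.exp α + ε)) : ℝ) : 𝕜) •
          (1 : Matrix m m 𝕜) + K * diagonal (fun k => ((Real.exp (-g k) - Real.exp (-gbar) : ℝ) : 𝕜)) * Kᴴ := by
  -- the levels `a_k = ḡ − g_k ∈ [0, α]`
  set a : n → ℝ := fun k => gbar - g k with ha_def
  have ha : ∀ k, |a k| ≤ α := fun k => by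
    rw [abs_of_nonneg (by simp only [ha_def]; linarith [hg k])]
    exact hgα k
  set θ : ℝ := Real.exp ((1 + ε) * α) - (1 + ε) * Real.exp α + ε with hθ
  set d₁ : Matrix n n 𝕜 := diagonal (fun k => ((Real.exp (a k) - 1 : ℝ) : 𝕜)) with hd₁
  set d₂ : Matrix n n 𝕜 := diagonal (fun k => ((Real.exp (-g k) - Real.exp (-gbar) : ℝ) : 𝕜)) with hd₂
  set E : Matrix m m 𝕜 := exp (K * diagonal (fun k => ((a k : ℝ) : 𝕜)) * Kᴴ) - 1 - K * d₁ * Kᴴ with hE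
  obtain ⟨hlo, hhi⟩ := exp_frameConj_diagonal_loewner hε hP hα ha
  rw [← hd₁, ← hE, ← hθ] at hlo hhi
  -- `−G = (−ḡ)·1 + K diag(a) Kᴴ` and `exp(−G) = e^{−ḡ} · exp(K diag(a) Kᴴ)`
  have hneg : -((((gbar : ℝ)) : 𝕜) • (1 : Matrix m m 𝕜) + K * diagonal (fun k => ((g k - gbar : ℝ) : 𝕜)) * Kᴴ) =
      (((-gbar : ℝ)) : 𝕜) • (1 : Matrix m m 𝕜) + K * diagonal (fun k => ((a k : ℝ) : 𝕜)) * Kᴴ := by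
    have hd : diagonal (fun k => ((a k : ℝ) : 𝕜)) = -diagonal (fun k => ((g k - gbar : ℝ) : 𝕜)) := by
      rw [diagonal_neg]
      congr 1
      funext k
      simp only [ha_def]
      push_cast
      ring
    rw [hd, RCLike.ofReal_neg, neg_smul, neg_add, Matrix.mul_neg, Matrix.neg_mul]
  have hc : exp ((((-gbar : ℝ)) : 𝕜)) = ((Real.exp (-gbar) : ℝ) : 𝕜) := by
    rw [Real.exp_eq_exp_ℝ]
    exact (algebraMap_exp_comm (𝔸 := 𝕜) (-gbar)).symm
  have hexp : exp (-((((gbar : ℝ)) : 𝕜) • (1 : Matrix m m 𝕜) +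
      K * diagonal (fun k => ((g k - gbar : ℝ) : 𝕜)) * Kᴴ)) = ((Real.exp (-gbar) : ℝ) : 𝕜) • (E + 1 + K * d₁ * Kᴴ) := by
    rw [hneg, exp_smul_one_add, hc, hE]
    congr 1
    abel
  -- the scaled diagonal: `e^{−ḡ} · K diag(e^{a} − 1) Kᴴ = K diag(e^{−g} − e^{−ḡ}) Kᴴ`
  have hf : ((Real.exp (-gbar) : ℝ) : 𝕜) • (fun k => ((Real.exp (a k) - 1 : ℝ) : 𝕜)) =
      fun k => ((Real.exp (-g k) - Real.exp (-gbar) : ℝ) : 𝕜) := by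
    funext k
    simp only [Pi.smul_apply, smul_eq_mul, ha_def]
    rw [← RCLike.ofReal_mul, mul_sub, mul_one, ← Real.exp_add, show -gbar + (gbar - g k) = -g k by ring]
  have hdiag : ((Real.exp (-gbar) : ℝ) : 𝕜) • (K * d₁ * Kᴴ) = K * d₂ * Kᴴ := by
    rw [← Matrix.smul_mul, ← Matrix.mul_smul, hd₁, hd₂, ← diagonal_smul, hf]
  have hpos : (0 : 𝕜) ≤ ((Real.exp (-gbar) : ℝ) : 𝕜) := RCLike.ofReal_nonneg.2 (Real.exp_pos _).le
  rw [hexp]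
  constructor
  · -- lower: RHS − LHS = e^{−ḡ} · (E + θ·1)
    rw [Matrix.le_iff]
    have hpsd : (E - -((((θ : ℝ)) : 𝕜) • (1 : Matrix m m 𝕜))).PosSemidef := Matrix.le_iff.1 hlo
    have e : ((Real.exp (-gbar) : ℝ) : 𝕜) • (E + 1 + K * d₁ * Kᴴ) -
        (((Real.exp (-gbar) * (1 - θ) : ℝ) : 𝕜) • (1 : Matrix m m 𝕜) + K * d₂ * Kᴴ) =
        ((Real.exp (-gbar) : ℝ) : 𝕜) • (E - -((((θ : ℝ)) : 𝕜) • (1 : Matrix m m 𝕜))) := by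
      rw [← hdiag]
      push_cast
      module
    rw [e]
    exact hpsd.smul hpos
  · -- upper: RHS − LHS = e^{−ḡ} · (θ·1 − E)
    rw [Matrix.le_iff]
    have hpsd : (((((θ : ℝ)) : 𝕜) • (1 : Matrix m m 𝕜)) - E).PosSemidef := Matrix.le_iff.1 hhi
    have e : ((Real.exp (-gbar) * (1 + θ) : ℝ) : 𝕜) • (1 : Matrix m m 𝕜) + K * d₂ * Kᴴ -
        ((Real.exp (-gbar) : ℝ) : 𝕜) • (E + 1 + K * d₁ * Kᴴ) =
        ((Real.exp (-gbar) : ℝ) : 𝕜) • (((((θ : ℝ)) : 𝕜) • (1 : Matrix m m 𝕜)) - E) := by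
      rw [← hdiag]
      push_cast
      module
    rw [e]
    exact hpsd.smul hpos

/-- **The same enclosure for `cfc Real.exp` over `ℂ`** (the form in which conditional free-energy certificates
`e^{c}·e^{L_B} − tr_x exp(−H + Γ L_B) ⪰ 0` are stated): for complex matrices and Hermitian `G` as above,
`cfc Real.exp (−G) = exp (−G)`, so both Loewner bounds hold verbatim for `cfc Real.exp (−G)`.
[cite: Higham2008, §10.1, Problem 1.33] [cite: HornJohnson2013, §7.7] -/
theorem cfc_exp_neg_shift_frameConj_loewner {m n : Type*} [Fintype m] [Fintype n] [DecidableEq m] [DecidableEq n]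
    {K : Matrix m n ℂ} {ε α gbar : ℝ} (hε : 0 ≤ ε) (hP : ‖Kᴴ * K - 1‖ ≤ ε) (hα : 0 ≤ α) {g : n → ℝ}
    (hg : ∀ k, g k ≤ gbar) (hgα : ∀ k, gbar - g k ≤ α) :
    ((Real.exp (-gbar) * (1 - (Real.exp ((1 + ε) * α) - (1 + ε) * Real.exp α + ε)) : ℝ) : ℂ) •
          (1 : Matrix m m ℂ) + K * diagonal (fun k => ((Real.exp (-g k) - Real.exp (-gbar) : ℝ) : ℂ)) * Kᴴ ≤
        cfc Real.exp (-((((gbar : ℝ)) : ℂ) • (1 : Matrix m m ℂ) +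
          K * diagonal (fun k => ((g k - gbar : ℝ) : ℂ)) * Kᴴ)) ∧
      cfc Real.exp (-((((gbar : ℝ)) : ℂ) • (1 : Matrix m m ℂ) +
          K * diagonal (fun k => ((g k - gbar : ℝ) : ℂ)) * Kᴴ)) ≤
        ((Real.exp (-gbar) * (1 + (Real.exp ((1 + ε) * α) - (1 + ε) * Real.exp α + ε)) : ℝ) : ℂ) •
          (1 : Matrix m m ℂ) + K * diagonal (fun k => ((Real.exp (-g k) - Real.exp (-gbar) : ℝ) : ℂ)) * Kᴴ := by
  have hG : (-((((gbar : ℝ)) : ℂ) • (1 : Matrix m m ℂ) +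
      K * diagonal (fun k => ((g k - gbar : ℝ) : ℂ)) * Kᴴ)).IsHermitian := by
    refine Matrix.IsHermitian.neg (Matrix.IsHermitian.add ?_ ?_)
    · unfold Matrix.IsHermitian
      rw [conjTranspose_smul, conjTranspose_one, Complex.star_def, Complex.conj_ofReal]
    · exact isHermitian_mul_mul_conjTranspose K (isHermitian_diagonal_ofReal fun k => g k - gbar)
  rw [CFC.real_exp_eq_normedSpace_exp hG.isSelfAdjoint]
  exact exp_neg_shift_frameConj_loewner hε hP hα hg hgα


/-! ### §3 The exact-arithmetic interface: entrywise sum of squares bounds the operator norm -/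

omit [Fintype m] [DecidableEq m] in
/-- **`‖E‖ ≤ ‖E‖_F`** in certificate form: if `Σ_{ij} |E_ij|² ≤ ε²` (`ε ≥ 0`; a check in exact rational arithmetic
for a rational Gram defect `E = KᵀK − 1`) then the `ℓ²`-operator norm satisfies `‖E‖ ≤ ε` (row-wise Cauchy–Schwarz).
[cite: HornJohnson2013, §5.6] -/
theorem l2_opNorm_le_of_sum_sq_le {E : Matrix n n 𝕜} {ε : ℝ} (hε : 0 ≤ ε)
    (h : ∑ i, ∑ j, ‖E i j‖ ^ 2 ≤ ε ^ 2) : ‖E‖ ≤ ε := by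
  rw [← Matrix.l2_opNorm_toEuclideanCLM]
  refine ContinuousLinearMap.opNorm_le_bound _ hε fun x => ?_
  rw [← sq_le_sq₀ (norm_nonneg _) (by positivity), mul_pow, EuclideanSpace.norm_sq_eq,
    EuclideanSpace.norm_sq_eq]
  have hrow : ∀ i, ‖(toEuclideanCLM (n := n) (𝕜 := 𝕜) E x) i‖ ^ 2 ≤ (∑ j, ‖E i j‖ ^ 2) * ∑ j, ‖x j‖ ^ 2 := by
    intro i
    have h1 : (toEuclideanCLM (n := n) (𝕜 := 𝕜) E x) i = ∑ j, E i j * x j := by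
      change WithLp.ofLp (toEuclideanCLM (n := n) (𝕜 := 𝕜) E x) i = _
      rw [ofLp_toEuclideanCLM]
      rfl
    rw [h1]
    calc ‖∑ j, E i j * x j‖ ^ 2 ≤ (∑ j, ‖E i j‖ * ‖x j‖) ^ 2 := by
          gcongr
          exact (norm_sum_le _ _).trans (le_of_eq (Finset.sum_congr rfl fun j _ => norm_mul _ _))
      _ ≤ (∑ j, ‖E i j‖ ^ 2) * ∑ j, ‖x j‖ ^ 2 := Finset.sum_mul_sq_le_sq_mul_sq _ _ _
  calc ∑ i, ‖(toEuclideanCLM (n := n) (𝕜 := 𝕜) E x) i‖ ^ 2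
      ≤ ∑ i, (∑ j, ‖E i j‖ ^ 2) * ∑ j, ‖x j‖ ^ 2 := Finset.sum_le_sum fun i _ => hrow i
    _ = (∑ i, ∑ j, ‖E i j‖ ^ 2) * ∑ j, ‖x j‖ ^ 2 := by rw [Finset.sum_mul]
    _ ≤ ε ^ 2 * ∑ j, ‖x j‖ ^ 2 := by gcongr

end FrameExponential

end Literature.LinearAlgebra.Matrix

end
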